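import Literature.NumberTheory.Automorphic.HidaEnginePointSupport
import Literature.Algebra.Module.FiniteModuleTorsionCard
import HarnessLib

/-!
# The uniform generator bound `hd₂` of the levelwise engine at a dominant ordinary point

Topic `NumberTheory/Automorphic`; namespace `Literature.NumberTheory.Automorphic.BigHeckeGLn.TameLevel`;
theorems only (no named fact, no `sorry`).

For the engine step `n` (twisted level module `E_n(2)` at `W = U(lv n, max(lv n,1))`, coefficients
`O/pⁿ`, `e_v c₀ ≤ b₁ ≤ lv n`, trivial weight constants, torus data of depth `c₀ ≥ 1`):

* `natCard_quotient_weightIdeal_le_two` — `#(E_n(2) / J E_n(2)) ≤ #(Ord H²(U', Sym) / p)` for the weight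
  ideal `J = (p, X_{d_q} − 1)` (`U' = U(b₁, c)`): the fibres of `m ↦ tr(res(Φ⁻¹ m)) mod p` lie in cosets
  of `J E_n(2)` (`HidaEngineLatticeDescent.exists_eq_smul_add_sum_two`);
* `natCard_torsion_ord_le`, `natCard_quotient_range_le_base` — `#(Ord H²(U')/p) = #Ord H²(U')[p] ≤
  #Ord H²(U₀)[p] ≤ #H²(U₀, Sym((O/pⁿ)²))[p] = #(H²(U₀, Sym((O/pⁿ)²))/p) ≤ #(H²(U₀, Sym(O²))/p)`
  (Hida's bijection, counting in finite modules, reduction onto in the top degree);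
* **`spanFinrank_top_le_two`** — hence `μ(E_n(2)) ≤ #(H²(U₀, Sym(O²)) / p)` uniformly in `n`
  (nilpotent Nakayama, `HidaEngineDiamondUnipotent`): hypothesis `hd₂` of the engine.

[cite: Hida1994AIF, §3, proof of Thm 3.2] [cite: KhareThorne2017, §6.5, Lemma 6.17]

## References

* H. Hida, Ann. Inst. Fourier 44 (1994), §3 (held). [Hida1994AIF]
* C. Khare, J. A. Thorne, Amer. J. Math. 139 (2017), §6.3–6.5 (arXiv:1409.7007, held). [KhareThorne2017]
-/

noncomputable section

open CategoryTheory IsDedekindDomain MvPolynomial Literature.Algebra.Module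
open scoped NumberField

namespace Literature.NumberTheory.Automorphic

namespace BigHeckeGLn

namespace TameLevel

open IntegralWeightGL2 LevelAction ParallelWeight PolyAction

variable {K : Type} [Field K] [NumberField K] {p : ℕ} [Fact p.Prime] (𝒰 : TameLevel 2 K p)
  [h𝒰 : Fact 𝒰.IsMaximalAbove] (O : Type) [CommRing O] {E : Type} [Field E] [CharZero E] (lv : ℕ → ℕ)
  {v : (K →+* E) → HeightOneSpectrum (𝓞 K)} (hv : ∀ τ, (p : 𝓞 K) ∈ (v τ).asIdeal)
  (φO : ∀ τ : K →+* E, (v τ).adicCompletionIntegers K →+* O) (n : ℕ)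
  (hred : ∀ τ (x : (v τ).adicCompletionIntegers K),
    Valued.v (x : (v τ).adicCompletion K) ≤ (WithZero.exp (-(lv n : ℤ)) : WithZero (Multiplicative ℤ)) →
      engRed p O φO n τ x = 0)
  (k c₀ : ℕ) {b₁ : ℕ} (hb₁ : ∀ w : PlacesAbove K p, BigHeckeGLn.ordAt w.1 (p : 𝓞 K) * c₀ ≤ b₁)
  (hb₁1 : 1 ≤ b₁) (hlvn : b₁ ≤ lv n)
  (hN : ∀ d : TorusDatum K p c₀,
    (∏ τ, engRed p O φO n τ ((d.units ⟨v τ, hv τ⟩ 1 : ((v τ).adicCompletionIntegers K)ˣ) :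
        (v τ).adicCompletionIntegers K) ^ (k - 2)) =
      Ideal.Quotient.mk (Ideal.span {((p : O)) ^ n}) (((Algebra.norm ℤ d.2.u : ℤ) : O) ^ (k - 2)))
  [Finite (𝒰.latCohomology O lv φO n k 2)] [Finite (𝒰.engCohomology O lv n 2)]
  [Finite (cohomology (globalEmbedding 2 K) (integralMonoid K v) (engLatAction p O φO n k)
    (𝒰.level (max (lv n) 1) (max (lv n) 1)) 2)]
  [Finite (cohomology (globalEmbedding 2 K) (integralMonoid K v) (engLatAction p O φO n k)
    (𝒰.level b₁ (max (lv n) 1)) 2)]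
  (hcd : ∀ (W : Subgroup (FiniteAdelicGL 2 K)),
    IsOpen (W : Set (FiniteAdelicGL 2 K)) → IsCompact (W : Set (FiniteAdelicGL 2 K)) →
    (∀ γ ∈ W.comap (globalEmbedding 2 K), IsOfFinOrder γ → γ = 1) →
    ∀ (A : Rep ℤ (W.comap (globalEmbedding 2 K))) (q : ℕ), 3 ≤ q → Subsingleton (groupCohomology A q))
  (htf : ∀ (x : FiniteAdelicGL 2 K) (γ : GL (Fin 2) K), IsOfFinOrder γ →
    x⁻¹ * globalEmbedding 2 K γ * x ∈ 𝒰.level b₁ (max (lv n) 1) → γ = 1)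

/-- The `Fin`-indexed torus data of the engine step. [folklore] -/
abbrev diamData : Fin (Fintype.card (𝒰.DiamIdx lv n (b₁ := b₁))) → TorusDatum K p c₀ :=
  fun i => 𝒰.diamDatum lv n c₀ hb₁ hlvn ((Fintype.equivFin _).symm i)

/-! ### Step 1: `#(E_n(2)/J E_n(2)) ≤ #(Ord H²(U')/p)` -/

include hN hb₁1 hcd htf hred in
/-- **The fibres of `m ↦ tr(res(Φ⁻¹ m)) mod p` lie in the cosets of `J · E_n(2)`**, whence
`#(E_n(2)/J·E_n(2)) ≤ #(Ord H²(U', Sym)/p)`. [cite: Hida1994AIF, §3, proof of Thm 3.2] -/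
theorem natCard_quotient_weightIdeal_le_two :
    Nat.card (𝒰.EngModTw O lv k c₀ n 2 ⧸ Ideal.span (Set.range (𝒰.weightFamily O (𝒰.diamData lv n c₀ hb₁ hlvn))) •
        (⊤ : Submodule (MvPolynomial (𝒰.Syms c₀) O) (𝒰.EngModTw O lv k c₀ n 2))) ≤
      Nat.card (𝒰.levOrd O hv φO n k b₁ (max (lv n) 1) 2 ⧸
        LinearMap.range (LinearMap.lsmul (engCoeff p O n) (𝒰.levOrd O hv φO n k b₁ (max (lv n) 1) 2) (Ideal.Quotient.mk (Ideal.span {((p : O)) ^ n}) (p : O)))) := by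
  classical
  have h1 : 1 ≤ lv n := hb₁1.trans hlvn
  have hbc : b₁ ≤ max (lv n) 1 := hlvn.trans (le_max_left _ _)
  have hc : 1 ≤ max (lv n) 1 := le_max_right _ _
  have hUW : 𝒰.level (max (lv n) 1) (max (lv n) 1) ≤ 𝒰.level (lv n) (max (lv n) 1) :=
    𝒰.level_antitone (le_max_left _ _) le_rfl
  have hbij := 𝒰.bijOn_engBridge O lv hv φO n hred k hb₁1 hlvn 2
  -- the lift and the map `G`
  have hl := fun m : 𝒰.EngModTw O lv k c₀ n 2 => 𝒰.exists_lift O lv hv φO n hred k c₀ hb₁1 hlvn 2 m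
  choose lift hlift hliftΦ using hl
  have htrres : ∀ m, (trCohomology (globalEmbedding 2 K) (integralMonoid K v) (engLatAction p O φO n k)
      (𝒰.level_le_integralMonoid_of_forall_mem hv (max (lv n) 1) (max (lv n) 1))
      (𝒰.level_le_integralMonoid_of_forall_mem hv b₁ (max (lv n) 1)) 2).hom
        ((resCohomology (globalEmbedding 2 K) (integralMonoid K v) (engLatAction p O φO n k) hUW 2).hom (lift m)) ∈
      𝒰.levOrd O hv φO n k b₁ (max (lv n) 1) 2 := fun m =>
    𝒰.trCohomology_mem_ordAtΔ hv _ h𝒰.out hbc le_rfl hc 2 (𝒰.resCohomology_mem_ordAtΔ hv _ h𝒰.out hUW hc hc 2 (hlift m))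
  haveI : Finite (𝒰.levOrd O hv φO n k b₁ (max (lv n) 1) 2 ⧸
      LinearMap.range (LinearMap.lsmul (engCoeff p O n) (𝒰.levOrd O hv φO n k b₁ (max (lv n) 1) 2)
        (Ideal.Quotient.mk (Ideal.span {((p : O)) ^ n}) (p : O)))) :=
    Finite.of_surjective _ (Submodule.mkQ_surjective _)
  refine natCard_quotient_le_of_forall_sub_mem _
    (fun m => Submodule.Quotient.mk (p := LinearMap.range (LinearMap.lsmul (engCoeff p O n)
      (𝒰.levOrd O hv φO n k b₁ (max (lv n) 1) 2) (Ideal.Quotient.mk (Ideal.span {((p : O)) ^ n}) (p : O)))) (⟨_, htrres m⟩ : 𝒰.levOrd O hv φO n k b₁ (max (lv n) 1) 2))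
    (fun m m' hmm' => ?_)
  rw [Submodule.Quotient.eq] at hmm'
  obtain ⟨a, ha⟩ := LinearMap.mem_range.1 hmm'
  rw [LinearMap.lsmul_apply] at ha
  have ha' := congrArg Subtype.val ha
  simp only [SetLike.val_smul, AddSubgroupClass.coe_sub] at ha'
  -- the difference of the lifts lifts the difference
  set y := lift m - lift m' with hydef
  have hy : y ∈ 𝒰.latOrd O lv hv φO n hred k 2 := Submodule.sub_mem _ (hlift m) (hlift m')
  have hyΦ : 𝒰.engBridge O lv hv φO n hred k 2 y = ((m - m').toEngMod : 𝒰.engCohomology O lv n 2) := by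
    rw [hydef, map_sub, hliftΦ, hliftΦ]; rfl
  have hyϖ : ∃ a ∈ 𝒰.levOrd O hv φO n k b₁ (max (lv n) 1) 2,
      (trCohomology (globalEmbedding 2 K) (integralMonoid K v) (engLatAction p O φO n k)
          (𝒰.level_le_integralMonoid_of_forall_mem hv (max (lv n) 1) (max (lv n) 1))
          (𝒰.level_le_integralMonoid_of_forall_mem hv b₁ (max (lv n) 1)) 2).hom
        ((resCohomology (globalEmbedding 2 K) (integralMonoid K v) (engLatAction p O φO n k) hUW 2).hom y) =
        (Ideal.Quotient.mk (Ideal.span {((p : O)) ^ n}) (p : O)) • a :=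
    ⟨a, a.2, by rw [hydef, map_sub, map_sub, ha']⟩
  obtain ⟨y'', hy'', b, hb, hsum⟩ := 𝒰.exists_eq_smul_add_sum_two O lv hv φO n k c₀ hb₁ hb₁1 hlvn hcd htf _ y hy hyϖ
  -- `m - m' = (C p) • m'' + ∑_q (X_{d_q} - 1) • m_q`
  have hΦy'' : 𝒰.engBridge O lv hv φO n hred k 2 y'' ∈ 𝒰.engOrd O lv n 2 := hbij.mapsTo hy''
  have hΦb : ∀ q, 𝒰.engBridge O lv hv φO n hred k 2 (b q) ∈ 𝒰.engOrd O lv n 2 := fun q => hbij.mapsTo (hb q)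
  set m'' : 𝒰.EngModTw O lv k c₀ n 2 := EngModTw.ofEngMod 𝒰 O lv k c₀ (EngMod.mk 𝒰 O lv _ hΦy'') with hm''
  set mq : 𝒰.DiamIdx lv n (b₁ := b₁) → 𝒰.EngModTw O lv k c₀ n 2 :=
    fun q => EngModTw.ofEngMod 𝒰 O lv k c₀ (EngMod.mk 𝒰 O lv _ (hΦb q)) with hmq
  have hdec : m - m' = (C (p : O) : MvPolynomial (𝒰.Syms c₀) O) • m'' +
      ∑ q, (X (Sum.inr (𝒰.diamDatum lv n c₀ hb₁ hlvn q)) - 1 : MvPolynomial (𝒰.Syms c₀) O) • mq q := by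
    refine EngMod.ext 𝒰 ?_
    change 𝒰.engModValHom O lv n k c₀ 2 (m - m') = 𝒰.engModValHom O lv n k c₀ 2 (_ + _)
    rw [map_add, map_sum, engModValHom_apply, ← hyΦ, hsum, map_add, map_smul, map_sum, engModValHom_apply, C_twSmul]
    congr 1
    · refine Finset.sum_congr rfl fun q _ => ?_
      rw [engModValHom_apply, 𝒰.coe_twSmul_of_lift O lv hv φO n hred k c₀ hb₁1 hlvn hN 2 _ (mq q) (hb q) (by rw [hmq]; rfl)]
      rfl
  rw [hdec]
  refine Submodule.add_mem _ (Submodule.smul_mem_smul (Ideal.subset_span ⟨0, rfl⟩) Submodule.mem_top)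
    (Submodule.sum_mem _ fun q _ => Submodule.smul_mem_smul (Ideal.subset_span ⟨(Fintype.equivFin _ q).succ, ?_⟩) Submodule.mem_top)
  simp [weightFamily, diamData]

/-! ### Step 2: `#(Ord H²(U')/p) ≤ #(H²(U₀, Sym((O/pⁿ)²))/p)` -/

omit [Finite (𝒰.latCohomology O lv φO n k 2)] [Finite (𝒰.engCohomology O lv n 2)]
  [Finite (cohomology (globalEmbedding 2 K) (integralMonoid K v) (engLatAction p O φO n k)
    (𝒰.level (max (lv n) 1) (max (lv n) 1)) 2)]
  [Finite (cohomology (globalEmbedding 2 K) (integralMonoid K v) (engLatAction p O φO n k)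
    (𝒰.level b₁ (max (lv n) 1)) 2)] in
include hb₁1 hlvn in
/-- **`#Ord H²(U', Sym)[p] ≤ #Ord H²(U₀, Sym)[p] ≤ #H²(U₀, Sym((O/pⁿ)²))[p]`** (Hida's bijection in the top
degree). [cite: KhareThorne2017, §6.3, Lemma 6.10] -/
theorem natCard_torsion_ord_le
    (hfin : ∀ (cv : PlacesAbove K p → ℕ) (i : ℕ),
      Finite (cohomology (globalEmbedding 2 K) (integralMonoid K v) (engLatAction p O φO n k) (𝒰.depthLevel b₁ cv) i))
    (ϖ : engCoeff p O n) :
    Nat.card (LinearMap.ker (LinearMap.lsmul (engCoeff p O n) (𝒰.levOrd O hv φO n k b₁ (max (lv n) 1) 2) ϖ)) ≤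
      Nat.card (LinearMap.ker (LinearMap.lsmul (engCoeff p O n)
        (cohomology (globalEmbedding 2 K) (integralMonoid K v) (engLatAction p O φO n k) (𝒰.level b₁ b₁) 2) ϖ)) := by
  classical
  have hbc : b₁ ≤ max (lv n) 1 := hlvn.trans (le_max_left _ _)
  haveI : Finite (cohomology (globalEmbedding 2 K) (integralMonoid K v) (engLatAction p O φO n k) (𝒰.level b₁ b₁) 2) :=
    hfin (fun _ => b₁) 2
  have hbij := bijOn_resCohomology_ordAtΔ (ι := globalEmbedding 2 K) (Δ := integralMonoid K v) (τ := engLatAction p O φO n k)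
    (hΔ := fun w : PlacesAbove K p => heckeElement_mem_integralMonoid v w.1 1)
    (hUΔ := fun cv => 𝒰.depthLevel_le_integralMonoid_of_forall_mem hv b₁ cv) h𝒰.out hfin
    (fun cv i w w' => 𝒰.commute_up_up_depthLevel h𝒰.out (engLatAction p O φO n k)
      (fun w : PlacesAbove K p => heckeElement_mem_integralMonoid v w.1 1)
      b₁ cv (𝒰.depthLevel_le_integralMonoid_of_forall_mem hv b₁ cv) i w w') hb₁1 le_rfl hbc 2
  set res := (resCohomology (globalEmbedding 2 K) (integralMonoid K v) (engLatAction p O φO n k)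
    (𝒰.level_antitone le_rfl hbc : 𝒰.level b₁ (max (lv n) 1) ≤ 𝒰.level b₁ b₁) 2).hom with hres
  -- Step A: `Ord(U')[ϖ]` is the image of `Ord(U₀)[ϖ]`
  let f : LinearMap.ker (LinearMap.lsmul (engCoeff p O n) (𝒰.levOrd O hv φO n k b₁ b₁ 2) ϖ) →
      LinearMap.ker (LinearMap.lsmul (engCoeff p O n) (𝒰.levOrd O hv φO n k b₁ (max (lv n) 1) 2) ϖ) :=
    fun a => ⟨⟨res a.1.1, hbij.mapsTo a.1.2⟩, by
      have h := congrArg Subtype.val ((LinearMap.mem_ker).1 a.2)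
      simp only [LinearMap.lsmul_apply, SetLike.val_smul, ZeroMemClass.coe_zero] at h
      refine (LinearMap.mem_ker).2 (Subtype.ext ?_)
      simp only [LinearMap.lsmul_apply, SetLike.val_smul, ZeroMemClass.coe_zero]
      rw [← res.map_smul, h, map_zero]⟩
  have hf : Function.Surjective f := by
    rintro ⟨⟨a', ha'⟩, hpa'⟩
    obtain ⟨a₀, ha₀, rfl⟩ := hbij.surjOn ha'
    have h0 : ϖ • a₀ = 0 := by
      have h := congrArg Subtype.val ((LinearMap.mem_ker).1 hpa')
      simp only [LinearMap.lsmul_apply, SetLike.val_smul, ZeroMemClass.coe_zero] at h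
      refine hbij.injOn (Submodule.smul_mem _ _ ha₀) (Submodule.zero_mem _) ?_
      rw [res.map_smul, map_zero]
      exact h
    refine ⟨⟨⟨a₀, ha₀⟩, (LinearMap.mem_ker).2 (Subtype.ext ?_)⟩, rfl⟩
    simp only [LinearMap.lsmul_apply, SetLike.val_smul, ZeroMemClass.coe_zero]
    exact h0
  -- Step B: `Ord(U₀)[ϖ] ⊆ H²(U₀)[ϖ]`
  let g : LinearMap.ker (LinearMap.lsmul (engCoeff p O n) (𝒰.levOrd O hv φO n k b₁ b₁ 2) ϖ) →
      LinearMap.ker (LinearMap.lsmul (engCoeff p O n)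
        (cohomology (globalEmbedding 2 K) (integralMonoid K v) (engLatAction p O φO n k) (𝒰.level b₁ b₁) 2) ϖ) :=
    fun a => ⟨a.1.1, by
      have h := congrArg Subtype.val ((LinearMap.mem_ker).1 a.2)
      simp only [LinearMap.lsmul_apply, SetLike.val_smul, ZeroMemClass.coe_zero] at h
      exact (LinearMap.mem_ker).2 h⟩
  have hg : Function.Injective g := fun a a' h => by
    have h' := congrArg Subtype.val h
    change a.1.1 = a'.1.1 at h'
    exact Subtype.ext (Subtype.ext h')
  exact (Nat.card_le_card_of_surjective f hf).trans (Nat.card_le_card_of_injective g hg)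

omit h𝒰 in
include hv in
/-- **`#(H²(U₀, Sym((O/pⁿ)²)) / p) ≤ #(H²(U₀, Sym(O²)) / p)`** (reduction onto in the top degree).
[cite: Hida1994AIF, §3] [cite: KhareThorne2017, §6.4] -/
theorem natCard_quotient_range_le_base [IsDomain O] (hpn : ((p : O)) ^ n ≠ 0)
    [Subsingleton (cohomology (globalEmbedding 2 K) (integralMonoid K v) (symLatticeAction O E K k v φO) (𝒰.level b₁ b₁) 3)]
    [Finite (cohomology (globalEmbedding 2 K) (integralMonoid K v) (symLatticeAction O E K k v φO) (𝒰.level b₁ b₁) 2 ⧸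
      Ideal.span {(p : O)} • (⊤ : Submodule O
        (cohomology (globalEmbedding 2 K) (integralMonoid K v) (symLatticeAction O E K k v φO) (𝒰.level b₁ b₁) 2)))] :
    Nat.card (cohomology (globalEmbedding 2 K) (integralMonoid K v) (engLatAction p O φO n k) (𝒰.level b₁ b₁) 2 ⧸
        LinearMap.range (LinearMap.lsmul (engCoeff p O n)
          (cohomology (globalEmbedding 2 K) (integralMonoid K v) (engLatAction p O φO n k) (𝒰.level b₁ b₁) 2)
          (Ideal.Quotient.mk (Ideal.span {((p : O)) ^ n}) (p : O)))) ≤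
      Nat.card (cohomology (globalEmbedding 2 K) (integralMonoid K v) (symLatticeAction O E K k v φO) (𝒰.level b₁ b₁) 2 ⧸
        Ideal.span {(p : O)} • (⊤ : Submodule O
          (cohomology (globalEmbedding 2 K) (integralMonoid K v) (symLatticeAction O E K k v φO) (𝒰.level b₁ b₁) 2))) := by
  classical
  set red := reductionCohomology O E K k v φO (Ideal.span {((p : O)) ^ n}) (globalEmbedding 2 K)
    (𝒰.level_le_integralMonoid_of_forall_mem hv b₁ b₁) 2 with hred'
  have hle : Ideal.span {(p : O)} • (⊤ : Submodule O
      (cohomology (globalEmbedding 2 K) (integralMonoid K v) (symLatticeAction O E K k v φO) (𝒰.level b₁ b₁) 2)) ≤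
      Submodule.comap red (LinearMap.range (LinearMap.lsmul (engCoeff p O n)
        (cohomology (globalEmbedding 2 K) (integralMonoid K v) (engLatAction p O φO n k) (𝒰.level b₁ b₁) 2)
        (Ideal.Quotient.mk (Ideal.span {((p : O)) ^ n}) (p : O)))) := by
    refine Submodule.smul_le.2 fun r hr x _ => ?_
    obtain ⟨a, rfl⟩ := Ideal.mem_span_singleton'.1 hr
    rw [Submodule.mem_comap, LinearMap.map_smulₛₗ, map_mul, mul_comm, mul_smul]
    exact LinearMap.mem_range.2 ⟨Ideal.Quotient.mk (Ideal.span {((p : O)) ^ n}) a • red x, by rw [LinearMap.lsmul_apply]⟩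
  let Ψ := Submodule.mapQ _ _ red hle
  have hΨ : Function.Surjective Ψ := by
    intro q
    induction q using Submodule.Quotient.induction_on with
    | H z =>
      obtain ⟨x, rfl⟩ := reductionCohomology_surjective_of_subsingleton O E K k v φO (((p : O)) ^ n) (globalEmbedding 2 K)
        (𝒰.level_le_integralMonoid_of_forall_mem hv b₁ b₁) 2 hpn z
      exact ⟨Submodule.Quotient.mk x, rfl⟩
  exact Nat.card_le_card_of_surjective Ψ hΨ

/-! ### Conclusion: `hd₂` -/

include hN hb₁ hlvn hb₁1 hcd htf hred hv in
/-- **`hd₂`: `μ_{O[Syms]}(E_n(2)) ≤ #(H²(U₀, Sym(O²)) / p)`**, uniformly in `n` (nilpotent Nakayama for the weight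
ideal, the fibre count, Hida's bijection, `#A[p] = #(A/pA)`, reduction onto).
[cite: Hida1994AIF, §3, proof of Thm 3.2] [cite: KhareThorne2017, §6.5, Lemma 6.17] -/
theorem spanFinrank_top_le_two
    (hN1 : ∀ d : TorusDatum K p c₀, (((Algebra.norm ℤ d.2.u : ℤ)) : O) ^ (k - 2) = 1) (hc₀ : 1 ≤ c₀)
    [IsDomain O] (hpn : ((p : O)) ^ n ≠ 0)
    (hfin : ∀ (cv : PlacesAbove K p → ℕ) (i : ℕ),
      Finite (cohomology (globalEmbedding 2 K) (integralMonoid K v) (engLatAction p O φO n k) (𝒰.depthLevel b₁ cv) i))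
    [Subsingleton (cohomology (globalEmbedding 2 K) (integralMonoid K v) (symLatticeAction O E K k v φO) (𝒰.level b₁ b₁) 3)]
    [Finite (cohomology (globalEmbedding 2 K) (integralMonoid K v) (symLatticeAction O E K k v φO) (𝒰.level b₁ b₁) 2 ⧸
      Ideal.span {(p : O)} • (⊤ : Submodule O
        (cohomology (globalEmbedding 2 K) (integralMonoid K v) (symLatticeAction O E K k v φO) (𝒰.level b₁ b₁) 2)))] :
    (⊤ : Submodule (MvPolynomial (𝒰.Syms c₀) O) (𝒰.EngModTw O lv k c₀ n 2)).spanFinrank ≤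
      Nat.card (cohomology (globalEmbedding 2 K) (integralMonoid K v) (symLatticeAction O E K k v φO) (𝒰.level b₁ b₁) 2 ⧸
        Ideal.span {(p : O)} • (⊤ : Submodule O
          (cohomology (globalEmbedding 2 K) (integralMonoid K v) (symLatticeAction O E K k v φO) (𝒰.level b₁ b₁) 2))) := by
  classical
  haveI : Finite (cohomology (globalEmbedding 2 K) (integralMonoid K v) (engLatAction p O φO n k) (𝒰.level b₁ b₁) 2) :=
    hfin (fun _ => b₁) 2
  obtain ⟨L, hL⟩ := 𝒰.exists_pow_weightIdeal_smul_top_eq_bot O lv hN1 hc₀ n 2 (𝒰.diamData lv n c₀ hb₁ hlvn)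
  haveI : Finite (𝒰.EngModTw O lv k c₀ n 2) := inferInstanceAs (Finite (𝒰.engOrd O lv n 2))
  haveI : Finite (𝒰.EngModTw O lv k c₀ n 2 ⧸ Ideal.span (Set.range (𝒰.weightFamily O (𝒰.diamData lv n c₀ hb₁ hlvn))) •
      (⊤ : Submodule (MvPolynomial (𝒰.Syms c₀) O) (𝒰.EngModTw O lv k c₀ n 2))) :=
    Finite.of_surjective _ (Submodule.mkQ_surjective _)
  calc (⊤ : Submodule (MvPolynomial (𝒰.Syms c₀) O) (𝒰.EngModTw O lv k c₀ n 2)).spanFinrank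
      ≤ Nat.card (𝒰.EngModTw O lv k c₀ n 2 ⧸ Ideal.span (Set.range (𝒰.weightFamily O (𝒰.diamData lv n c₀ hb₁ hlvn))) •
          (⊤ : Submodule (MvPolynomial (𝒰.Syms c₀) O) (𝒰.EngModTw O lv k c₀ n 2))) :=
        spanFinrank_top_le_natCard_quotient _ hL
    _ ≤ Nat.card (𝒰.levOrd O hv φO n k b₁ (max (lv n) 1) 2 ⧸
          LinearMap.range (LinearMap.lsmul (engCoeff p O n) (𝒰.levOrd O hv φO n k b₁ (max (lv n) 1) 2) (Ideal.Quotient.mk (Ideal.span {((p : O)) ^ n}) (p : O)))) :=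
        𝒰.natCard_quotient_weightIdeal_le_two O lv hv φO n hred k c₀ hb₁ hb₁1 hlvn hN hcd htf
    _ = Nat.card (LinearMap.ker (LinearMap.lsmul (engCoeff p O n) (𝒰.levOrd O hv φO n k b₁ (max (lv n) 1) 2) (Ideal.Quotient.mk (Ideal.span {((p : O)) ^ n}) (p : O)))) :=
        (natCard_ker_eq_natCard_quotient_range _).symm
    _ ≤ Nat.card (LinearMap.ker (LinearMap.lsmul (engCoeff p O n)
          (cohomology (globalEmbedding 2 K) (integralMonoid K v) (engLatAction p O φO n k) (𝒰.level b₁ b₁) 2) (Ideal.Quotient.mk (Ideal.span {((p : O)) ^ n}) (p : O)))) :=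
        𝒰.natCard_torsion_ord_le O lv hv φO n k hb₁1 hlvn hfin _
    _ = Nat.card (cohomology (globalEmbedding 2 K) (integralMonoid K v) (engLatAction p O φO n k) (𝒰.level b₁ b₁) 2 ⧸
          LinearMap.range (LinearMap.lsmul (engCoeff p O n)
            (cohomology (globalEmbedding 2 K) (integralMonoid K v) (engLatAction p O φO n k) (𝒰.level b₁ b₁) 2) (Ideal.Quotient.mk (Ideal.span {((p : O)) ^ n}) (p : O)))) :=
        natCard_ker_eq_natCard_quotient_range _
    _ ≤ _ := 𝒰.natCard_quotient_range_le_base O hv φO n k hpn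

end TameLevel

end BigHeckeGLn

end Literature.NumberTheory.Automorphic
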